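import Literature.Analysis.FluidPDE.HardSpherePhaseSpace
import HarnessLib

/-!
# The hard-sphere phase space: discharged facts (proofs)

`Literature.Analysis.FluidPDE.HardSpherePhaseSpace` records, next to the torus geometry of the
hard-sphere model (Gallagher–Saint-Raymond–Texier 2013, Ch. 4 intro: hard spheres on `T^d` with
the Euclidean distance of nearest images; Cercignani–Illner–Pulvirenti 1994 §4.2), some
elementary properties of the symmetric representative `Torus.reprSym : T^d → (-1/2, 1/2]^d ⊂ ℝ^d`,
of the minimal-image distance `Torus.euclidDist`, and of free flight as named facts. This file
proves them:

* `Torus.norm_reprSym_le_holds` — `‖reprSym x‖ ≤ √d / 2`: every coordinate of `reprSym x` lies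
  in `(-1/2, 1/2]` (`Torus.reprSym_apply_mem_Ioc`), so `‖reprSym x‖² = ∑ᵢ |reprSym x i|² ≤ d/4`;
* `Torus.euclidDist_proj_le_norm_sub_holds` — `dist_{T^d}(proj a, proj b) ≤ ‖a - b‖`:
  coordinatewise the quotient norm on `ℝ/ℤ` is at most the absolute value of any lift
  (`UnitAddCircle.norm_eq`, `round_le`), and `|reprSym y i| = ‖y i‖` (`Torus.abs_reprSym_apply`);
* `Torus.norm_sub_le_euclidDist_holds`, `Torus.euclidDist_le_holds` — the minimal-image
  Euclidean distance and Mathlib's sup-distance on the pi type `UnitAddTorus d` are equivalent: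
  `‖x - y‖_∞ ≤ dist_{T^d}(x, y) ≤ √d ‖x - y‖_∞` (a coordinate is at most the `ℓ²` norm,
  `PiLp.norm_apply_le`; the `ℓ²` norm of `d` coordinates each `≤ r` is `≤ √d r`);
* `Kinetic.measurePreserving_shear` — a shear `(x, v) ↦ (τ_v x, v)` along measure-preserving
  maps `τ_v` preserves a product measure (Mathlib's `MeasurePreserving.skew_product`, conjugated
  by `Prod.swap`); hence `Kinetic.measurePreserving_freeFlight_of_translate` — free flight
  `(x_i, v_i) ↦ (x_i + t v_i, v_i)` preserves `volume` on `(X × ℝ^d)^N` for every geometry whose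
  translations preserve `volume` on `X` (`MeasureTheory.volume_preserving_pi`) — and the
  discharge `Kinetic.measurePreserving_freeFlight_holds` of the whole-space fact
  `Kinetic.measurePreserving_freeFlight` (CIP 1994 §4.2: Lebesgue measure `dx dv` is invariant
  under free streaming, the collisionless Liouville theorem).

The torus analogue `Kinetic.measurePreserving_freeFlight_torus` is already discharged in
`Literature.Barriers.AtomisticToContinuum.BoltzmannHypothesis`
(`measurePreserving_freeFlight_torus_holds`, via the ideal-gas state); it is also the special
case `G = Torus.geometry d` of `Kinetic.measurePreserving_freeFlight_of_translate`.

No new definitions.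

## References

* C. Cercignani, R. Illner, M. Pulvirenti, *The Mathematical Theory of Dilute Gases* (1994),
  §4.2 (hard-sphere dynamics; invariance of Lebesgue measure under the free flow).
* I. Gallagher, L. Saint-Raymond, B. Texier, *From Newton to Boltzmann: hard spheres and
  short-range potentials* (2013), Ch. 4 (introduction): the periodic box and minimal images.
-/

open MeasureTheory Measure Real Set

namespace Literature.Analysis.FluidPDE

noncomputable section

/-! ## The symmetric representative and the minimal-image distance -/

namespace Torus

variable {d : Type*}

/-- A coordinate of the symmetric representative has square at most `1/4`
(from `reprSym_apply_mem_Ioc`: it lies in `(-1/2, 1/2]`). [folklore] -/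
theorem norm_reprSym_apply_sq_le (x : UnitAddTorus d) (i : d) :
    ‖reprSym x i‖ ^ 2 ≤ (1 / 2 : ℝ) ^ 2 := by
  have hmem := reprSym_apply_mem_Ioc x i
  rw [Real.norm_eq_abs, sq_abs]
  exact sq_le_sq' (by linarith [hmem.1]) hmem.2

variable [Fintype d]

/-- Discharge of the named fact `Torus.norm_reprSym_le`: the symmetric (minimal-image)
representative of a point of `T^d` has Euclidean norm at most `√d / 2` — each of its `d`
coordinates is at most `1/2` in absolute value, and `‖y‖ = √(∑ᵢ |yᵢ|²)` on `ℝ^d`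
(`EuclideanSpace.norm_eq`). In particular the minimal-image distance on the unit flat torus is
bounded by `√d / 2`, half the diagonal of the unit cube (GST 2013 Ch. 4 intro: the periodic box
with nearest-image distance). [folklore] -/
theorem norm_reprSym_le_holds : norm_reprSym_le (d := d) := by
  intro x
  have hsum : ∑ i, ‖reprSym x i‖ ^ 2 ≤ Fintype.card d * (1 / 2 : ℝ) ^ 2 := by
    calc ∑ i, ‖reprSym x i‖ ^ 2 ≤ ∑ _i : d, (1 / 2 : ℝ) ^ 2 :=
          Finset.sum_le_sum fun i _ => norm_reprSym_apply_sq_le x i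
      _ = Fintype.card d * (1 / 2 : ℝ) ^ 2 := by
          rw [Finset.sum_const, Finset.card_univ, nsmul_eq_mul]
  rw [EuclideanSpace.norm_eq]
  calc √(∑ i, ‖reprSym x i‖ ^ 2) ≤ √(Fintype.card d * (1 / 2 : ℝ) ^ 2) := Real.sqrt_le_sqrt hsum
    _ = √(Fintype.card d : ℝ) / 2 := by
        rw [Real.sqrt_mul' _ (sq_nonneg _), Real.sqrt_sq (by norm_num : (0 : ℝ) ≤ 1 / 2)]
        ring

/-- Discharge of the named fact `Torus.euclidDist_proj_le_norm_sub`: the minimal-image distance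
of two projected points is at most their distance in `ℝ^d`,
`dist_{T^d}(proj a, proj b) = ‖reprSym (proj (a - b))‖ ≤ ‖a - b‖`. Coordinatewise,
`|reprSym (proj c) i| = ‖(c i : ℝ/ℤ)‖` (`abs_reprSym_apply`) and the quotient norm of the class
of a real number `t` is `|t - round t| ≤ |t|` (`UnitAddCircle.norm_eq`, `round_le`); then sum
the squares (GST 2013 Ch. 4 intro: the distance of nearest images is a minimum over lattice
translates, attained in particular by the translate `0`). [folklore] -/
theorem euclidDist_proj_le_norm_sub_holds : euclidDist_proj_le_norm_sub (d := d) := by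
  intro a b
  have hcoe : ∀ t : ℝ, ‖((t : ℝ) : UnitAddCircle)‖ ≤ |t| := fun t => by
    rw [UnitAddCircle.norm_eq]
    simpa using round_le t 0
  rw [euclidDist_eq, show FunctionSpaces.Torus.proj a - FunctionSpaces.Torus.proj b = FunctionSpaces.Torus.proj (a - b) from rfl, EuclideanSpace.norm_eq,
    EuclideanSpace.norm_eq]
  refine Real.sqrt_le_sqrt (Finset.sum_le_sum fun i _ => ?_)
  rw [Real.norm_eq_abs, Real.norm_eq_abs, abs_reprSym_apply]
  exact pow_le_pow_left₀ (norm_nonneg _) (hcoe _) 2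

/-- Discharge of the named fact `Torus.norm_sub_le_euclidDist`: Mathlib's sup-distance on the
pi type `UnitAddTorus d = d → ℝ/ℤ` is dominated by the minimal-image Euclidean distance,
`‖x - y‖_∞ ≤ ‖reprSym (x - y)‖`: each coordinate satisfies `‖(x - y) i‖ = |reprSym (x - y) i|`
(`abs_reprSym_apply`), which is at most the `ℓ²` norm of the vector (`PiLp.norm_apply_le`). [folklore] -/
theorem norm_sub_le_euclidDist_holds : norm_sub_le_euclidDist (d := d) := by
  intro x y
  rw [euclidDist_eq, pi_norm_le_iff_of_nonneg (norm_nonneg _)]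
  intro i
  rw [← abs_reprSym_apply, ← Real.norm_eq_abs]
  exact PiLp.norm_apply_le (reprSym (x - y)) i

/-- Discharge of the named fact `Torus.euclidDist_le`: the minimal-image Euclidean distance is at
most `√d` times Mathlib's sup-distance on `UnitAddTorus d`,
`‖reprSym (x - y)‖ = √(∑ᵢ ‖(x - y) i‖²) ≤ √(d ‖x - y‖_∞²) = √d ‖x - y‖_∞`
(`abs_reprSym_apply`, `norm_le_pi_norm`). [folklore] -/
theorem euclidDist_le_holds : euclidDist_le (d := d) := by
  intro x y
  rw [euclidDist_eq, EuclideanSpace.norm_eq]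
  have hsum : ∑ i, ‖reprSym (x - y) i‖ ^ 2 ≤ Fintype.card d * ‖x - y‖ ^ 2 := by
    calc ∑ i, ‖reprSym (x - y) i‖ ^ 2 ≤ ∑ _i : d, ‖x - y‖ ^ 2 :=
          Finset.sum_le_sum fun i _ => by
            rw [Real.norm_eq_abs, abs_reprSym_apply]
            exact pow_le_pow_left₀ (norm_nonneg _) (norm_le_pi_norm (x - y) i) 2
      _ = Fintype.card d * ‖x - y‖ ^ 2 := by
          rw [Finset.sum_const, Finset.card_univ, nsmul_eq_mul]
  calc √(∑ i, ‖reprSym (x - y) i‖ ^ 2) ≤ √(Fintype.card d * ‖x - y‖ ^ 2) :=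
        Real.sqrt_le_sqrt hsum
    _ = √(Fintype.card d : ℝ) * ‖x - y‖ := by
        rw [Real.sqrt_mul' _ (sq_nonneg _), Real.sqrt_sq (norm_nonneg _)]

end Torus

/-! ## Free flight preserves Lebesgue measure -/

section Kinetic

/-- **Shears preserve product measures.** If every fibre map `τ v : X → X` pushes `μ` to itself
and `(v, x) ↦ τ v x` is jointly measurable, then the shear `(x, v) ↦ (τ v x, v)` preserves
`μ ⊗ ν` (Mathlib's `MeasureTheory.MeasurePreserving.skew_product` for `(v, x) ↦ (v, τ v x)`,
conjugated by the measure-preserving `Prod.swap`). The case `τ v x = x + t v` is the invariance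
of `dx dv` under free streaming (CIP 1994 §4.2). [folklore] -/
theorem measurePreserving_shear {X V : Type*} [MeasurableSpace X] [MeasurableSpace V]
    {μ : Measure X} {ν : Measure V} [SFinite μ] [SFinite ν]
    (τ : V → X → X) (hτ : Measurable (Function.uncurry τ)) (h : ∀ v, μ.map (τ v) = μ) :
    MeasurePreserving (fun p : X × V => (τ p.2 p.1, p.2)) (μ.prod ν) (μ.prod ν) := by
  have hskew : MeasurePreserving (fun p : V × X => (id p.1, τ p.1 p.2)) (ν.prod μ) (ν.prod μ) :=
    (MeasurePreserving.id ν).skew_product hτ (ae_of_all _ h)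
  have : (fun p : X × V => (τ p.2 p.1, p.2)) =
      Prod.swap ∘ (fun p : V × X => (id p.1, τ p.1 p.2)) ∘ Prod.swap := rfl
  rw [this]
  exact measurePreserving_swap.comp (hskew.comp measurePreserving_swap)

variable {N : ℕ} {d : Type*} [Fintype d] {X : Type*} [MeasureSpace X]

/-- **Liouville's theorem for free transport, abstract form.** For a geometry `G` on a position
space `X` with a σ-finite `volume` such that translation `(x, v) ↦ x + v` is jointly measurable
and every translation `x ↦ x + v` preserves `volume`, free flight for time `t`,
`(x_i, v_i)_i ↦ (x_i + t v_i, v_i)_i`, preserves `volume` on the whole phase space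
`(X × ℝ^d)^N`: it is the product over the `N` particles (`MeasureTheory.volume_preserving_pi`)
of the shear `(x, v) ↦ (x + t v, v)` (`measurePreserving_shear`) (CIP 1994 §4.2). Both
`Euclidean.geometry d` (Lebesgue measure) and `Torus.geometry d` (Haar measure) qualify. [cite: CIP1994, §4.2] -/
theorem measurePreserving_freeFlight_of_translate [SigmaFinite (volume : Measure X)]
    {G : Geometry d X} (hmeas : Measurable fun p : X × EuclideanSpace ℝ d => G.translate p.1 p.2)
    (hinv : ∀ v, Measure.map (G.translate · v) volume = volume) (t : ℝ) :
    MeasurePreserving (freeFlight (N := N) G t) volume volume := by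
  have h1 : MeasurePreserving
      (fun p : X × EuclideanSpace ℝ d => (G.translate p.1 (t • p.2), p.2)) volume volume := by
    rw [volume_eq_prod]
    refine measurePreserving_shear (fun v x => G.translate x (t • v)) ?_ fun v => hinv (t • v)
    exact hmeas.comp (measurable_snd.prodMk (measurable_fst.const_smul t))
  exact volume_preserving_pi fun _ : Fin N => h1

/-- Discharge of the named fact `Kinetic.measurePreserving_freeFlight`: free flight preserves
Lebesgue measure on the whole phase space `(ℝ^d × ℝ^d)^N` (a shear in each factor; Liouville's
theorem for free transport, CIP 1994 §4.2) — `measurePreserving_freeFlight_of_translate` for the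
Euclidean geometry, whose translations `x ↦ x + v` preserve Lebesgue measure
(`MeasureTheory.map_add_right_eq_self`). [cite: CIP1994, §4.2] -/
theorem measurePreserving_freeFlight_holds : measurePreserving_freeFlight (N := N) (d := d) := by
  intro t
  exact measurePreserving_freeFlight_of_translate (measurable_fst.add measurable_snd)
    (fun v => map_add_right_eq_self volume v) t

end Kinetic

end

end Literature.Analysis.FluidPDE
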